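import Mathlib
import HarnessLib
import Summits.Ventures.LatticeQCDFlow.Scaling.AcceptanceGiniFloor
import Summits.Ventures.LatticeQCDFlow.Scoring.PooledESS

/-!
# LatticeQCDFlow / Scoring — the flow trainer's acceptance MONITOR on one proposal batch:
# Gini form, the two ESS floors it obeys on EVERY batch, and its sorted `O(n log n)` evaluation

HONEST FRAMING: exact (Metropolis-corrected) sampling algorithms for lattice gauge theory;
figures of merit are autocorrelation/cost numbers at stated couplings and volumes; no
continuum-physics claim.

Venture `LatticeQCDFlow` (cell pub-lqcd), sub-topic `Scoring`; FANOUT row 3 (`s0-u1-a`, S0-B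
implementation A, GEN-6).  NEW WORK of the cell (finite-sum bookkeeping), not a published result;
NO definition is introduced.  Companion of row 3's `Scaling/AcceptanceGiniFloor` (population laws:
`1 − acc = ½ E_{q⊗q}|w − w′|`, `acc ≥ 1 − √((1/ESS − 1)/2)`, `acc ≥ ESS/2`) and of row 11's
`Scoring/IMHAcceptanceFromWeights` (`acc = E_{q⊗q}[min(W, W′)]/E_q W`; gauge's plug-in
`gaugeEstimator_eq`) and `Scoring/PooledESS` (`kishESS`).

## The object

The U(1) flow trainer of record (engine `latflow.flows_jax` 0.2.1, `training.py` ll. 61–73, the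
trainer every arm-A run used) prints two monitors per checkpoint, both computed from ONE fresh batch
of `n` i.i.d. proposals with un-normalised importance weights `W_1 … W_n > 0`:

* `ess`     = `kish_ess_frac` = `(ΣW)² / (n ΣW²)` = `kishESS univ W / n`;
* `acc_est` = `imh_acceptance_estimate` = `Σ_{i ≠ j} min(W_i, W_j) / ((n − 1) ΣW)`, documented there as
  the self-normalised estimate of the EQUILIBRIUM acceptance `E_{x∼p} E_{x′∼q} min(1, w(x′)/w(x))`
  and evaluated as `2 Σ_k (n − k) w_(k) / ((n − 1) ΣW)` over the ascending order statistics.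

Typed here (all statements about one fixed batch; nothing probabilistic, nothing asymptotic):

* `accRate_selfNorm_uniform`, `essFrac_selfNorm_uniform` — the plug-in `V = Σ_iΣ_j min(W_i,W_j)/(nΣW)`
  and the Kish fraction ARE the tree's population `accRate` / `essFrac` of the self-normalised law
  `W/ΣW` against the uniform law on the batch; hence every population law applies to the batch:
  `half_kishFrac_le_plugIn` (`V ≥ ess/2`), `one_sub_plugIn_eq` (`1 − V = Σ_iΣ_j|W_i − W_j|/(2nΣW)`, the
  sample Gini coefficient), `sq_one_sub_plugIn_le` / `one_sub_sqrt_half_le_plugIn`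
  (`V ≥ 1 − √((1/ess − 1)/2)`).
* the monitor itself (U-statistic normalisation, diagonal removed): `sum_erase_min_eq`
  (`Σ_{i≠j} min = Σ_{i,j} min − ΣW`), `accMonitor_mem_Icc` (`0 ≤ acc_est ≤ 1`),
  **`accMonitor_eq_plugIn`** (`acc_est = (n·V − 1)/(n − 1)`: the plug-in exceeds the monitor by
  exactly `(1 − acc_est)/n`, the self-pair bias gauge's A29 form carries),
  **`half_kishESS_sub_one_div_le_accMonitor`** (`acc_est ≥ (Kish/2 − 1)/(n − 1)`, `Kish = n·ess`),
  **`one_sub_accMonitor_eq`** (`1 − acc_est = Σ_{i≠j}|W_i − W_j| / (2(n−1)ΣW)`: the monitor's deficit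
  IS the sample Gini coefficient of the batch weights) and **`one_sub_accMonitor_le`**
  (`1 − acc_est ≤ (n/(n−1))·√((1/ess − 1)/2)`).
* `sum_erase_min_eq_sorted` — for weights listed in non-decreasing order,
  `Σ_{i≠j} min(W_i, W_j) = 2 Σ_i (n − 1 − i) W_i` (0-indexed): the sorted evaluation is exact.

Reading (value-free; no number of record moves, nothing is re-scored): on every checkpoint line of
a training ledger the two printed monitors satisfy `acc_est ≥ (n·ess/2 − 1)/(n − 1)` and
`acc_est ≥ 1 − (n/(n−1))√((1/ess − 1)/2)` IDENTICALLY — a pair violating either is an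
implementation defect, not a statistical fluctuation; and `1 − acc_est` may be read as the Gini
coefficient of the batch's importance weights.  NOT CLAIMED: unbiasedness or any sampling-error
statement for `acc_est` as an estimator of the equilibrium acceptance (it is a ratio of a
U-statistic and a sample mean); any relation between the monitor and the CHAIN's realised
acceptance; any number of ours.

Elementary (`[folklore]`-level); farm `lean check` rc 0, no `sorry`.
-/

namespace Summit.Ventures.LatticeQCDFlow.Scoring

open Finset
open Summit.Ventures.LatticeQCDFlow.Exactness
open Summit.Ventures.LatticeQCDFlow.Theory2

section Batch

variable {ι : Type*} [Fintype ι]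

/-! ### The batch as a finite importance-sampling problem: target `W/ΣW`, model uniform -/

/-- The uniform law on the batch index set sums to one. [folklore] -/
theorem sum_uniform_eq_one [Nonempty ι] :
    ∑ _i : ι, ((Fintype.card ι : ℝ))⁻¹ = 1 := by
  rw [sum_const, card_univ, nsmul_eq_mul,
    mul_inv_cancel₀ (Nat.cast_pos.2 Fintype.card_pos).ne']

/-- The self-normalised batch law `W_i / ΣW` sums to one. [folklore] -/
theorem sum_selfNorm_eq_one [Nonempty ι] {W : ι → ℝ} (hW : ∀ i, 0 < W i) :
    ∑ i, W i / ∑ j, W j = 1 := by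
  rw [← sum_div, div_self (sum_pos (fun i _ => hW i) univ_nonempty).ne']

/-- **The plug-in acceptance is a population acceptance.**  For positive batch weights `W`, the
tree's `accRate` of the self-normalised law `W/ΣW` against the uniform law on the batch is the
V-statistic `Σ_i Σ_j min(W_i, W_j) / (n·ΣW)` (gauge's A29 estimator, `gaugeEstimator_eq`). -/
theorem accRate_selfNorm_uniform [Nonempty ι] {W : ι → ℝ} (hW : ∀ i, 0 < W i) :
    accRate (fun i => W i / ∑ j, W j) (fun _ => ((Fintype.card ι : ℝ))⁻¹)
      = (∑ i, ∑ j, min (W i) (W j)) / (Fintype.card ι * ∑ i, W i) := by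
  have hS : 0 < ∑ j, W j := sum_pos (fun i _ => hW i) univ_nonempty
  have hn : 0 < (Fintype.card ι : ℝ) := Nat.cast_pos.2 Fintype.card_pos
  have key : ∀ i j, min (W i / (∑ j, W j) * ((Fintype.card ι : ℝ))⁻¹)
      (W j / (∑ j, W j) * ((Fintype.card ι : ℝ))⁻¹)
      = min (W i) (W j) / (Fintype.card ι * ∑ j, W j) := by
    intro i j
    have e : ∀ k, W k / (∑ j, W j) * ((Fintype.card ι : ℝ))⁻¹
        = W k / (Fintype.card ι * ∑ j, W j) := fun k => by
      rw [← div_eq_mul_inv, div_div, mul_comm]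
    rw [e, e, min_div_div_right (mul_pos hn hS).le]
  simp only [accRate, key]
  simp_rw [← sum_div]

/-- **The batch Kish fraction is a population ESS fraction.**  `essFrac (W/ΣW) (uniform) =
(ΣW)² / (n·ΣW²)` — the trainer's `kish_ess_frac` monitor. -/
theorem essFrac_selfNorm_uniform [Nonempty ι] {W : ι → ℝ} (hW : ∀ i, 0 < W i) :
    essFrac (fun i => W i / ∑ j, W j) (fun _ => ((Fintype.card ι : ℝ))⁻¹)
      = (∑ i, W i) ^ 2 / (Fintype.card ι * ∑ i, W i ^ 2) := by
  have hS : 0 < ∑ j, W j := sum_pos (fun i _ => hW i) univ_nonempty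
  have hn : 0 < (Fintype.card ι : ℝ) := Nat.cast_pos.2 Fintype.card_pos
  rw [essFrac_eq_inv (fun _ => inv_pos.2 hn) (sum_selfNorm_eq_one hW)]
  simp only [weight]
  have e : ∀ i, W i / (∑ j, W j) * (W i / (∑ j, W j) / ((Fintype.card ι : ℝ))⁻¹)
      = (Fintype.card ι : ℝ) / (∑ j, W j) ^ 2 * W i ^ 2 := fun i => by
    field_simp
  simp_rw [e]
  rw [← mul_sum]
  field_simp

/-- The batch Kish fraction is `kishESS univ W / n` in the vocabulary of `Scoring/PooledESS`. -/
theorem kishESS_univ_div_card (W : ι → ℝ) :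
    kishESS univ W / Fintype.card ι = (∑ i, W i) ^ 2 / (Fintype.card ι * ∑ i, W i ^ 2) := by
  rw [kishESS, div_div, mul_comm]

/-! ### The population floors, read on the batch -/

/-- **Plug-in acceptance ≥ half the Kish fraction**: `Σ_iΣ_j min(W_i,W_j)/(n ΣW) ≥ (ΣW)²/(2n ΣW²)`
on EVERY positive batch (the finite `essFrac_half_le_accRate` at the empirical law). -/
theorem half_kishFrac_le_plugIn [Nonempty ι] {W : ι → ℝ} (hW : ∀ i, 0 < W i) :
    (∑ i, W i) ^ 2 / (Fintype.card ι * ∑ i, W i ^ 2) / 2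
      ≤ (∑ i, ∑ j, min (W i) (W j)) / (Fintype.card ι * ∑ i, W i) := by
  have hS : 0 < ∑ j, W j := sum_pos (fun i _ => hW i) univ_nonempty
  have hn : 0 < (Fintype.card ι : ℝ) := Nat.cast_pos.2 Fintype.card_pos
  have h := essFrac_half_le_accRate (p := fun i => W i / ∑ j, W j)
    (q := fun _ => ((Fintype.card ι : ℝ))⁻¹) (fun i => div_pos (hW i) hS)
    (fun _ => inv_pos.2 hn) (sum_selfNorm_eq_one hW)
  rwa [accRate_selfNorm_uniform hW, essFrac_selfNorm_uniform hW] at h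

/-- **The plug-in acceptance deficit is the sample Gini coefficient** (V-statistic form):
`1 − Σ_iΣ_j min(W_i,W_j)/(n ΣW) = Σ_iΣ_j |W_i − W_j| / (2 n ΣW)`. -/
theorem one_sub_plugIn_eq [Nonempty ι] {W : ι → ℝ} (hW : ∀ i, 0 < W i) :
    1 - (∑ i, ∑ j, min (W i) (W j)) / (Fintype.card ι * ∑ i, W i)
      = (∑ i, ∑ j, |W i - W j|) / (2 * (Fintype.card ι * ∑ i, W i)) := by
  have hS : 0 < ∑ j, W j := sum_pos (fun i _ => hW i) univ_nonempty
  have hn : 0 < (Fintype.card ι : ℝ) := Nat.cast_pos.2 Fintype.card_pos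
  have h := one_sub_accRate_eq_half_qq_abs_weight (p := fun i => W i / ∑ j, W j)
    (q := fun _ => ((Fintype.card ι : ℝ))⁻¹) (fun _ => inv_pos.2 hn) (sum_selfNorm_eq_one hW)
    sum_uniform_eq_one
  rw [accRate_selfNorm_uniform hW] at h
  rw [h]
  simp only [weight]
  have e : ∀ i j, ((Fintype.card ι : ℝ))⁻¹ * ((Fintype.card ι : ℝ))⁻¹ *
      |W i / (∑ j, W j) / ((Fintype.card ι : ℝ))⁻¹ - W j / (∑ j, W j) / ((Fintype.card ι : ℝ))⁻¹|
      = |W i - W j| / (Fintype.card ι * ∑ j, W j) := by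
    intro i j
    rw [← sub_div, ← sub_div, abs_div, abs_div, abs_of_pos (inv_pos.2 hn), abs_of_pos hS]
    field_simp
  simp_rw [e, ← sum_div]
  rw [div_div]
  ring

/-- **`(1 − plug-in)² ≤ (1/Kish-fraction − 1)/2`** on every positive batch. -/
theorem sq_one_sub_plugIn_le [Nonempty ι] {W : ι → ℝ} (hW : ∀ i, 0 < W i) :
    (1 - (∑ i, ∑ j, min (W i) (W j)) / (Fintype.card ι * ∑ i, W i)) ^ 2
      ≤ ((Fintype.card ι * ∑ i, W i ^ 2) / (∑ i, W i) ^ 2 - 1) / 2 := by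
  have hS : 0 < ∑ j, W j := sum_pos (fun i _ => hW i) univ_nonempty
  have hn : 0 < (Fintype.card ι : ℝ) := Nat.cast_pos.2 Fintype.card_pos
  have h := sq_one_sub_accRate_le_half (p := fun i => W i / ∑ j, W j)
    (q := fun _ => ((Fintype.card ι : ℝ))⁻¹) (fun _ => inv_pos.2 hn) (sum_selfNorm_eq_one hW)
    sum_uniform_eq_one
  rwa [accRate_selfNorm_uniform hW, essFrac_selfNorm_uniform hW, inv_div] at h

/-- **Plug-in acceptance ≥ `1 − √((1/Kish-fraction − 1)/2)`** on every positive batch. -/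
theorem one_sub_sqrt_half_le_plugIn [Nonempty ι] {W : ι → ℝ} (hW : ∀ i, 0 < W i) :
    1 - Real.sqrt (((Fintype.card ι * ∑ i, W i ^ 2) / (∑ i, W i) ^ 2 - 1) / 2)
      ≤ (∑ i, ∑ j, min (W i) (W j)) / (Fintype.card ι * ∑ i, W i) := by
  have hS : 0 < ∑ j, W j := sum_pos (fun i _ => hW i) univ_nonempty
  have hn : 0 < (Fintype.card ι : ℝ) := Nat.cast_pos.2 Fintype.card_pos
  have h := one_sub_sqrt_half_le_accRate (p := fun i => W i / ∑ j, W j)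
    (q := fun _ => ((Fintype.card ι : ℝ))⁻¹) (fun _ => inv_pos.2 hn) (sum_selfNorm_eq_one hW)
    sum_uniform_eq_one
  rwa [accRate_selfNorm_uniform hW, essFrac_selfNorm_uniform hW, inv_div] at h

/-! ### The trainer's monitor: the U-statistic (off-diagonal) form -/

variable [DecidableEq ι]

/-- Removing the diagonal: `Σ_i Σ_{j ≠ i} min(W_i, W_j) = Σ_i Σ_j min(W_i, W_j) − ΣW`. [folklore] -/
theorem sum_erase_min_eq (W : ι → ℝ) :
    ∑ i, ∑ j ∈ univ.erase i, min (W i) (W j) = ∑ i, ∑ j, min (W i) (W j) - ∑ i, W i := by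
  have h : ∀ i, ∑ j ∈ univ.erase i, min (W i) (W j) = ∑ j, min (W i) (W j) - W i := fun i => by
    rw [sum_erase_eq_sub (mem_univ i), min_self]
  simp_rw [h]
  rw [sum_sub_distrib]

/-- Removing the diagonal changes nothing for the absolute differences. [folklore] -/
theorem sum_erase_abs_sub_eq (W : ι → ℝ) :
    ∑ i, ∑ j ∈ univ.erase i, |W i - W j| = ∑ i, ∑ j, |W i - W j| := by
  refine sum_congr rfl fun i _ => ?_
  rw [sum_erase_eq_sub (mem_univ i), sub_self, abs_zero, sub_zero]

/-- The off-diagonal min-sum is at most `(n − 1)·ΣW` (`min(W_i, W_j) ≤ W_j`). [folklore] -/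
theorem sum_erase_min_le (W : ι → ℝ) :
    ∑ i, ∑ j ∈ univ.erase i, min (W i) (W j) ≤ (Fintype.card ι - 1) * ∑ i, W i := by
  calc ∑ i, ∑ j ∈ univ.erase i, min (W i) (W j)
      ≤ ∑ i, ∑ j ∈ univ.erase i, W j :=
        sum_le_sum fun i _ => sum_le_sum fun j _ => min_le_right _ _
    _ = ∑ i, (∑ j, W j - W i) :=
        sum_congr rfl fun i _ => sum_erase_eq_sub (mem_univ i)
    _ = (Fintype.card ι - 1) * ∑ i, W i := by
        rw [sum_sub_distrib, sum_const, card_univ, nsmul_eq_mul]; ring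

/-- The off-diagonal min-sum of non-negative weights is non-negative. [folklore] -/
theorem sum_erase_min_nonneg {W : ι → ℝ} (hW : ∀ i, 0 ≤ W i) :
    0 ≤ ∑ i, ∑ j ∈ univ.erase i, min (W i) (W j) :=
  sum_nonneg fun i _ => sum_nonneg fun j _ => le_min (hW i) (hW j)

/-- **The monitor lies in `[0, 1]`** — for non-negative weights on a non-empty batch,
`0 ≤ Σ_iΣ_{j≠i} min(W_i,W_j) / ((n − 1)ΣW) ≤ 1` (at `n = 1` the value is Lean's `0/0 = 0`). -/
theorem accMonitor_mem_Icc [Nonempty ι] {W : ι → ℝ} (hW : ∀ i, 0 ≤ W i) :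
    (∑ i, ∑ j ∈ univ.erase i, min (W i) (W j)) / ((Fintype.card ι - 1) * ∑ i, W i)
      ∈ Set.Icc (0 : ℝ) 1 := by
  have hn1 : 0 ≤ (Fintype.card ι : ℝ) - 1 := by
    have : (1 : ℝ) ≤ Fintype.card ι := Nat.one_le_cast.2 Fintype.card_pos
    linarith
  have hden : 0 ≤ ((Fintype.card ι : ℝ) - 1) * ∑ i, W i :=
    mul_nonneg hn1 (sum_nonneg fun i _ => hW i)
  exact ⟨div_nonneg (sum_erase_min_nonneg hW) hden,
    div_le_one_of_le₀ (sum_erase_min_le W) hden⟩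

/-- **Monitor = rescaled plug-in**: with `n ≥ 2` proposals,
`Σ_iΣ_{j≠i} min / ((n−1)ΣW) = (n·V − 1)/(n − 1)` where `V = Σ_iΣ_j min / (nΣW)` is the plug-in;
hence the plug-in over-states the monitor by exactly `(1 − monitor)/n`. -/
theorem accMonitor_eq_plugIn {W : ι → ℝ} (hW : ∀ i, 0 < W i) (hn : 2 ≤ Fintype.card ι) :
    (∑ i, ∑ j ∈ univ.erase i, min (W i) (W j)) / ((Fintype.card ι - 1) * ∑ i, W i)
      = (Fintype.card ι * ((∑ i, ∑ j, min (W i) (W j)) / (Fintype.card ι * ∑ i, W i)) - 1)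
          / (Fintype.card ι - 1) := by
  haveI : Nonempty ι := Fintype.card_pos_iff.1 (by omega)
  have hS : (∑ j, W j) ≠ 0 := (sum_pos (fun i _ => hW i) univ_nonempty).ne'
  have hn0 : (Fintype.card ι : ℝ) ≠ 0 := (Nat.cast_pos.2 Fintype.card_pos).ne'
  have hn1 : (Fintype.card ι : ℝ) - 1 ≠ 0 := by
    have : (2 : ℝ) ≤ Fintype.card ι := by exact_mod_cast hn
    linarith
  rw [sum_erase_min_eq]
  field_simp

/-- **The two printed monitors can never cross this line**: on every positive batch of `n ≥ 2`
proposals, `acc-monitor ≥ (Kish/2 − 1)/(n − 1)` where `Kish = (ΣW)²/ΣW² = kishESS univ W`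
(so, up to `O(1/n)`, the acceptance estimate is at least half the ESS fraction). -/
theorem half_kishESS_sub_one_div_le_accMonitor {W : ι → ℝ} (hW : ∀ i, 0 < W i)
    (hn : 2 ≤ Fintype.card ι) :
    (kishESS univ W / 2 - 1) / (Fintype.card ι - 1)
      ≤ (∑ i, ∑ j ∈ univ.erase i, min (W i) (W j)) / ((Fintype.card ι - 1) * ∑ i, W i) := by
  haveI : Nonempty ι := Fintype.card_pos_iff.1 (by omega)
  have hnpos : 0 < (Fintype.card ι : ℝ) := Nat.cast_pos.2 Fintype.card_pos
  have hn1 : 0 < (Fintype.card ι : ℝ) - 1 := by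
    have : (2 : ℝ) ≤ Fintype.card ι := by exact_mod_cast hn
    linarith
  rw [accMonitor_eq_plugIn hW hn]
  refine div_le_div_of_nonneg_right ?_ hn1.le
  have h := half_kishFrac_le_plugIn hW
  rw [← kishESS_univ_div_card] at h
  have h2 : kishESS univ W / 2
      ≤ Fintype.card ι * ((∑ i, ∑ j, min (W i) (W j)) / (Fintype.card ι * ∑ i, W i)) := by
    have h3 := mul_le_mul_of_nonneg_left h hnpos.le
    have e : (Fintype.card ι : ℝ) * (kishESS univ W / Fintype.card ι / 2) = kishESS univ W / 2 := by
      field_simp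
    linarith [h3, e]
  linarith

/-- **The monitor's deficit is the sample Gini coefficient** (U-statistic normalisation):
`1 − Σ_iΣ_{j≠i} min(W_i,W_j)/((n−1)ΣW) = Σ_iΣ_{j≠i}|W_i − W_j| / (2(n−1)ΣW)`, `n ≥ 2`. -/
theorem one_sub_accMonitor_eq {W : ι → ℝ} (hW : ∀ i, 0 < W i) (hn : 2 ≤ Fintype.card ι) :
    1 - (∑ i, ∑ j ∈ univ.erase i, min (W i) (W j)) / ((Fintype.card ι - 1) * ∑ i, W i)
      = (∑ i, ∑ j ∈ univ.erase i, |W i - W j|) / (2 * ((Fintype.card ι - 1) * ∑ i, W i)) := by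
  haveI : Nonempty ι := Fintype.card_pos_iff.1 (by omega)
  have hS : (∑ j, W j) ≠ 0 := (sum_pos (fun i _ => hW i) univ_nonempty).ne'
  have hn0 : (Fintype.card ι : ℝ) ≠ 0 := (Nat.cast_pos.2 Fintype.card_pos).ne'
  have hn1 : (Fintype.card ι : ℝ) - 1 ≠ 0 := by
    have : (2 : ℝ) ≤ Fintype.card ι := by exact_mod_cast hn
    linarith
  have hV := one_sub_plugIn_eq hW
  rw [accMonitor_eq_plugIn hW hn, sum_erase_abs_sub_eq]
  -- `1 − (nV − 1)/(n−1) = n(1 − V)/(n−1)` and `1 − V = G/(2nS)`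
  have e : 1 - (Fintype.card ι * ((∑ i, ∑ j, min (W i) (W j)) / (Fintype.card ι * ∑ i, W i)) - 1)
        / (Fintype.card ι - 1)
      = Fintype.card ι * (1 - (∑ i, ∑ j, min (W i) (W j)) / (Fintype.card ι * ∑ i, W i))
        / (Fintype.card ι - 1) := by
    field_simp
    ring
  rw [e, hV]
  field_simp

/-- **Monitor floor from the Kish fraction, Gini form**: on every positive batch of `n ≥ 2`
proposals, `1 − acc-monitor ≤ (n/(n−1)) · √((n·ΣW²/(ΣW)² − 1)/2)`
(`n ΣW²/(ΣW)² = n/Kish = 1/ESS-fraction`). -/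
theorem one_sub_accMonitor_le {W : ι → ℝ} (hW : ∀ i, 0 < W i) (hn : 2 ≤ Fintype.card ι) :
    1 - (∑ i, ∑ j ∈ univ.erase i, min (W i) (W j)) / ((Fintype.card ι - 1) * ∑ i, W i)
      ≤ Fintype.card ι / (Fintype.card ι - 1)
        * Real.sqrt (((Fintype.card ι * ∑ i, W i ^ 2) / (∑ i, W i) ^ 2 - 1) / 2) := by
  haveI : Nonempty ι := Fintype.card_pos_iff.1 (by omega)
  have hnpos : 0 < (Fintype.card ι : ℝ) := Nat.cast_pos.2 Fintype.card_pos
  have hn1 : 0 < (Fintype.card ι : ℝ) - 1 := by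
    have : (2 : ℝ) ≤ Fintype.card ι := by exact_mod_cast hn
    linarith
  have hV := one_sub_sqrt_half_le_plugIn hW
  rw [accMonitor_eq_plugIn hW hn]
  -- `1 − (nV − 1)/(n−1) = n(1 − V)/(n−1) ≤ n·s/(n−1)`
  have e : 1 - (Fintype.card ι * ((∑ i, ∑ j, min (W i) (W j)) / (Fintype.card ι * ∑ i, W i)) - 1)
        / (Fintype.card ι - 1)
      = Fintype.card ι / (Fintype.card ι - 1)
        * (1 - (∑ i, ∑ j, min (W i) (W j)) / (Fintype.card ι * ∑ i, W i)) := by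
    field_simp
    ring
  rw [e]
  exact mul_le_mul_of_nonneg_left (by linarith) (div_pos hnpos hn1).le

end Batch

/-! ### The sorted `O(n log n)` evaluation used by the trainer -/

section Sorted

/-- **Sorted evaluation of the off-diagonal min-sum.**  For weights listed in non-decreasing order
(`W : Fin n → ℝ` monotone), `Σ_i Σ_{j ≠ i} min(W_i, W_j) = 2·Σ_i (n − 1 − i)·W_i` (0-indexed):
the formula `2 Σ_k (n − k) w_(k)` (1-indexed ascending order statistics) of the trainer's
`imh_acceptance_estimate`. [folklore] -/
theorem sum_erase_min_eq_sorted {n : ℕ} (W : Fin n → ℝ) (hW : Monotone W) :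
    ∑ i, ∑ j ∈ univ.erase i, min (W i) (W j) = 2 * ∑ i : Fin n, ((n : ℝ) - 1 - (i : ℕ)) * W i := by
  -- off the diagonal, `min(W_i, W_j)` is `W_j` if `j < i` and `W_i` if `i < j`
  have hterm : ∀ i j : Fin n, j ≠ i →
      min (W i) (W j) = (if j < i then W j else 0) + (if i < j then W i else 0) := by
    intro i j hij
    rcases lt_or_gt_of_ne hij with h | h
    · rw [if_pos h, if_neg (not_lt.2 h.le), add_zero, min_eq_right (hW h.le)]
    · rw [if_neg (not_lt.2 h.le), if_pos h, zero_add, min_eq_left (hW h.le)]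
  have hsplit : ∀ i : Fin n, ∑ j ∈ univ.erase i, min (W i) (W j)
      = ∑ j, (if j < i then W j else 0) + ∑ j, (if i < j then W i else 0) := by
    intro i
    rw [sum_congr rfl fun j hj => hterm i j (ne_of_mem_erase hj), sum_erase_eq_sub (mem_univ i),
      sum_add_distrib]
    simp
  -- each indicator sum counts the `n − 1 − i` indices above `i`
  have hB : ∀ i : Fin n, ∑ j, (if i < j then W i else 0) = ((n : ℝ) - 1 - (i : ℕ)) * W i := by
    intro i
    rw [← sum_filter, sum_const, nsmul_eq_mul, Finset.filter_lt_eq_Ioi, Fin.card_Ioi]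
    have h1 : (i : ℕ) ≤ n - 1 := Nat.le_sub_one_of_lt i.isLt
    have h2 : 1 ≤ n := i.pos
    rw [Nat.cast_sub h1, Nat.cast_sub h2, Nat.cast_one]
  have hA : ∑ i : Fin n, ∑ j : Fin n, (if j < i then W j else (0 : ℝ))
      = ∑ j : Fin n, ((n : ℝ) - 1 - (j : ℕ)) * W j := by
    rw [sum_comm]
    exact sum_congr rfl fun j _ => hB j
  have hB' : ∑ i : Fin n, ∑ j : Fin n, (if i < j then W i else (0 : ℝ))
      = ∑ i : Fin n, ((n : ℝ) - 1 - (i : ℕ)) * W i :=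
    sum_congr rfl fun i _ => hB i
  simp_rw [hsplit]
  rw [sum_add_distrib, hA, hB']
  ring

end Sorted

end Summit.Ventures.LatticeQCDFlow.Scoring
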